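import Literature.Computability.QuantumComplexity.MSubspaceSignReadoutCodeFP

/-!
# Crux `CubicForrelation.SignedExactCubicForrelationNotPrBPP` (stmt-QuantumAdvantage-13932), line `dual-pingpong-frame`:
# the finder machine `findV2`, I — linear-algebra bricks over `𝔽₂` and their `CodeFP`

Support file (`--supports stmt-QuantumAdvantage-13932`) toward the registered sub-goals `findV2_mem_FP` /
`findV2_sound` (the MACHINE half of the line's last open stub `stub_finder`). The finder (next file,
`…FinderMachine.lean`) is a deterministic polynomial-time search for rows spanning a half-dimensional
M-subspace of the second function `g` of a two-circuit instance, by rank-filtered radical seeds of the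
third-derivative tensor, two-tensor orbit closure, certified greedy merge and radical descent. This file
supplies the pure list bricks it is written in, each with its typed polynomial-time certificate (`CodeFP`,
Arora–Barak 2009, §1.3) assembled from the combinators of `CodeFP*.lean`, the row reduction of
`F2RowReduction.lean` (`rrun`, `isPiv`, `prow`, `kvec`, `npiv`), the select-and-xor `QuadSampler.xorSel` and
the second differences `MMReadout.d2` of the readout machine:

* vectors/matrices as bit lists: `normV` (pad/cut to length `n`), `mulVec` (matrix × vector), `sliceT`
  (the slice `B_w = Σ_j w_j T[·][j][·]` of a 3-tensor), `basisOf` (normalised pivot rows of the reduced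
  form: a basis of the row span), `kerOf` (the kernel vectors of the free columns: a basis of the right
  kernel), `inSpan` (rank test), `bitsOfNat` / `spanPrefix` (the first `min(2^d, β)` elements of the span of
  `d` vectors — all of it when `2^d ≤ β`, a polynomial budget);
* the tensor of a circuit: `d3` (third difference at `0` along three unit vectors, `8` evaluations),
  `tensorOf`, `unitSlices`, the radical `radOf w = ker B_w` and the rank test `rankTrue`
  (`u ≠ 0 ∧ 2·dim R_u ≥ n`), and the seed list `seedsOf` of the unit probes;
* a fold combinator with an INVARIANT-based size bound (`foldlInv`): the one hypothesis of `CodeFP.foldl`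
  (the accumulator code stays polynomially bounded along the run) discharged from an invariant of the
  genuine run and a bound on invariant states; with the shape invariant `Shaped n` (at most `n` rows of at
  most `n` bits, code length `≤ n(8n+2)`, `length_matE_le`) this carries every loop of the finder.

No statement here depends on the hidden structure of the instance; the algebraic meaning of the bricks
(e.g. `radOf` is the radical of a symmetric slice) is only used by the completeness analysis (lead's stub).

## References

* S. Arora, B. Barak, *Computational Complexity: A Modern Approach*, CUP 2009, §1.3 (polynomial time:
  composition and polynomially bounded loops). [AroraBarak2009]
* D. E. Knuth, *TAOCP* Vol. 2, 3rd ed., §4.6.2 Algorithm N (null space / rank by column reduction). [KnuthTAOCP2]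
* A. Kipnis, A. Shamir, *Cryptanalysis of the HFE public key cryptosystem by relinearization*, CRYPTO 1999,
  §4 (kernels of pencils of quadratic forms as the invariant to search — the radical seeds). [KipnisShamir1999]
-/

noncomputable section

set_option linter.dupNamespace false -- D-0017: single-problem summit ⇒ `QuantumAdvantage.QuantumAdvantage` by design

namespace Summit.QuantumAdvantage.QuantumAdvantage.Theorems.SignedExactCubicForrelationNotPrBPP.FinderMachine

open _root_.Computability Literature.Computability.Complexity Literature.Computability.Complexity.CodeFP
open Literature.Computability.QuantumComplexity
open Literature.Computability.Complexity.F2Elim (bxorL Row rrun isPiv prow kvec bitsE stCE)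
open ForrCode QuadSampler MMReadout

/-! ### Types and codes -/

/-- Bit vectors. [folklore] -/
abbrev Vec : Type := List Bool

/-- Bit matrices (lists of rows). [folklore] -/
abbrev Mat : Type := List (List Bool)

/-- Bit 3-tensors `T[i][j][k]`. [folklore] -/
abbrev Ten : Type := List (List (List Bool))

/-- The code of a matrix: raw list of raw bit lists. [folklore] -/
abbrev matE : Mat → List Bool := rawE bitsE

/-- The code of a tensor. [folklore] -/
abbrev tenE : Ten → List Bool := rawE matE

/-! ### A fold with an invariant-based size bound -/

variable {α β σ : Type} {eα : α → List Bool} {eβ : β → List Bool} {eσ : σ → List Bool}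

/-- **Left fold whose genuine run keeps an invariant with polynomially bounded codes.** If every state of
the run from `init s` satisfies `Q s`, and `Q s b` bounds `|eβ b|` by `P(|eσ s|)`, the fold is computed on
codes (the hypothesis of `CodeFP.foldl`, discharged once and for all). [cite: AroraBarak2009, §1.3] -/
theorem foldlInv {step : σ → α → β → β} {init : σ → β} (Q : σ → β → Prop)
    (hstep : CodeFP (pairE eσ (pairE eα eβ)) eβ (fun t => step t.1 t.2.1 t.2.2)) (hinit : CodeFP eσ eβ init)
    (P : Polynomial ℕ) (hQi : ∀ s, Q s (init s)) (hQs : ∀ s a b, Q s b → Q s (step s a b))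
    (hle : ∀ s b, Q s b → (eβ b).length ≤ P.eval (eσ s).length) :
    CodeFP (pairE eσ (rawE eα)) eβ (fun p => p.2.foldl (fun b a => step p.1 a b) (init p.1)) := by
  refine CodeFP.foldl hstep hinit P fun s l₁ l₂ => ?_
  have hQ : ∀ l : List α, Q s (l.foldl (fun b a => step s a b) (init s)) := fun l => by
    induction l using List.reverseRecOn with
    | nil => exact hQi s
    | append_singleton l a ih => rw [List.foldl_append, List.foldl_cons, List.foldl_nil]; exact hQs s a _ ih
  refine (hle s _ (hQ l₁)).trans (TM2Iter.eval_mono P ?_)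
  simp only [pairE_apply, length_boolPair]; omega

/-- A bit list of length `L` has code length `4L`. [folklore] -/
theorem length_bitsE (v : Vec) : (bitsE v).length = 4 * v.length := by
  simp only [bitsE, length_rawE, bitE, List.length_singleton, List.map_const', List.sum_replicate, smul_eq_mul]; ring

/-- **Code length of a shaped matrix** (at most `n` rows of at most `n` bits): `≤ n (8n + 2)`. [folklore] -/
theorem length_matE_le {n : ℕ} {M : Mat} (h : M.length ≤ n ∧ ∀ r ∈ M, r.length ≤ n) : (matE M).length ≤ n * (8 * n + 2) := by
  have h1 := BravyiGosset.length_rawE_le_of_forall bitsE M (4 * n) fun r hr => by rw [length_bitsE]; exact Nat.mul_le_mul_left 4 (h.2 r hr)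
  exact h1.trans (by have := h.1; nlinarith)

/-- The bounding polynomial `X (8X + 2)` of shaped states. [folklore] -/
def shapeP : Polynomial ℕ := Polynomial.X * (8 * Polynomial.X + 2)

/-- `shapeP` evaluates to `L (8L + 2)`. [folklore] -/
theorem shapeP_eval (L : ℕ) : shapeP.eval L = L * (8 * L + 2) := by simp [shapeP]

/-- A shaped matrix has code bounded by `shapeP` of any `L ≥ n` (e.g. the length of a context code that
starts with `n` in unary). [folklore] -/
theorem length_matE_le_shapeP {n L : ℕ} {M : Mat} (h : M.length ≤ n ∧ ∀ r ∈ M, r.length ≤ n) (hL : n ≤ L) :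
    (matE M).length ≤ shapeP.eval L := by
  rw [shapeP_eval]; exact (length_matE_le h).trans (Nat.mul_le_mul hL (by omega))

/-! ### Vectors and matrices -/

/-- Normalisation of a bit list to length `n` (pad with `0` / truncate). [folklore] -/
def normV (n : ℕ) (r : Vec) : Vec := (List.range n).map fun i => r.getD i false

/-- `|normV n r| = n`. [folklore] -/
@[simp] theorem length_normV (n : ℕ) (r : Vec) : (normV n r).length = n := by simp [normV]

/-- Matrix × vector over `𝔽₂`: `(B v)_u = B_u · v` (first `n` entries). [folklore] -/
def mulVec (n : ℕ) (B : Mat) (v : Vec) : Vec := B.map fun row => dotL n row v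

/-- The slice of a 3-tensor at `w`: `B_w[i][k] = Σ_j w_j T[i][j][k]`. [cite: KipnisShamir1999, §4] -/
def sliceT (n : ℕ) (T : Ten) (w : Vec) : Mat := T.map fun Ti => xorSel n Ti w

/-- **A basis of the row span**: the pivot rows of the reduced echelon form, normalised to length `n`.
[cite: KnuthTAOCP2, §4.6.2 Algorithm N] -/
def basisOf (n : ℕ) (M : Mat) : Mat :=
  ((List.range n).filter fun c => isPiv (rrun n M) c).map fun c => normV n (prow (rrun n M) c)

/-- **A basis of the right kernel** `{d | M d = 0}`: the kernel vectors of the free columns.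
[cite: KnuthTAOCP2, §4.6.2 Algorithm N] -/
def kerOf (n : ℕ) (M : Mat) : Mat :=
  ((List.range n).filter fun c => !isPiv (rrun n M) c).map fun c => kvec n (rrun n M) c

/-- The bits of `s` (least significant first), `d` of them. [folklore] -/
def bitsOfNat (d s : ℕ) : Vec := (List.range d).map fun j => decide (s / 2 ^ j % 2 = 1)

/-- **Budgeted span enumeration**: the first `min (2^d) β` combinations `⊕_{j : bit j of s} B_j` of the `d`
rows of `B` — the whole span when `2^d ≤ β`. [folklore] -/
def spanPrefix (n bud : ℕ) (B : Mat) : Mat :=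
  (List.range (min (2 ^ B.length) bud)).map fun s => xorSel n B (bitsOfNat B.length s)

/-- `basisOf` is shaped: at most `n` rows, each of length `n`. [folklore] -/
theorem shaped_basisOf (n : ℕ) (M : Mat) : (basisOf n M).length ≤ n ∧ ∀ r ∈ basisOf n M, r.length ≤ n := by
  refine ⟨?_, fun r hr => ?_⟩
  · rw [basisOf, List.length_map]; exact (List.length_filter_le _ _).trans (List.length_range.le)
  · obtain ⟨c, -, rfl⟩ := List.mem_map.1 hr; rw [length_normV]

/-! ### `CodeFP` of the vector bricks -/

/-- Normalisation on codes. [cite: AroraBarak2009, §1.3] -/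
theorem normV_codeFP : CodeFP (pairE unE bitsE) bitsE (fun p => normV p.1 p.2) := by
  have hm := CodeFP.map (σ := List Bool) (eσ := bitsE) (eα := natE) (eβ := bitE) (g := fun t => t.1.getD t.2 false) F2Elim.getDBit_codeFP
  exact (hm.comp ((snd _ _).pair (urange.comp (fst _ _)))).congr fun _ => rfl

/-- Matrix × vector on codes: `(n, (B, v)) ↦ mulVec n B v`. [cite: AroraBarak2009, §1.3] -/
theorem mulVec_codeFP : CodeFP (pairE unE (pairE matE bitsE)) bitsE (fun t => mulVec t.1 t.2.1 t.2.2) := by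
  have hm := CodeFP.map (σ := ℕ × List Bool) (eσ := pairE unE bitsE) (eα := bitsE) (eβ := bitE)
    (g := fun q => dotL q.1.1 q.2 q.1.2) (dotL_codeFP.comp ((fst _ _).fst'.pair ((snd _ _).pair (fst _ _).snd')))
  exact (hm.comp (((fst _ _).pair (snd _ _).snd').pair (snd _ _).fst')).congr fun _ => rfl

/-- Tensor slices on codes: `(n, (T, w)) ↦ sliceT n T w`. [cite: AroraBarak2009, §1.3] -/
theorem sliceT_codeFP : CodeFP (pairE unE (pairE tenE bitsE)) matE (fun t => sliceT t.1 t.2.1 t.2.2) := by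
  have hm := CodeFP.map (σ := ℕ × List Bool) (eσ := pairE unE bitsE) (eα := matE) (eβ := bitsE)
    (g := fun q => xorSel q.1.1 q.2 q.1.2) (xorSel_codeFP.comp ((fst _ _).fst'.pair ((snd _ _).pair (fst _ _).snd')))
  exact (hm.comp (((fst _ _).pair (snd _ _).snd').pair (snd _ _).fst')).congr fun _ => rfl

/-- The row-span basis on codes. [cite: AroraBarak2009, §1.3] -/
theorem basisOf_codeFP : CodeFP (pairE unE matE) matE (fun p => basisOf p.1 p.2) := by
  -- context `(n, S)` with `S = rrun n M`; item `c`
  have hn : CodeFP (pairE (pairE unE stCE) natE) unE (fun q => q.1.1) := (fst _ _).fst'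
  have hS : CodeFP (pairE (pairE unE stCE) natE) stCE (fun q => q.1.2) := (fst _ _).snd'
  have hc : CodeFP (pairE (pairE unE stCE) natE) natE (fun q => q.2) := snd _ _
  have hf := CodeFP.filter (σ := ℕ × List Row) (eσ := pairE unE stCE) (eα := natE) (p := fun q => isPiv q.1.2 q.2)
    (F2Elim.isPiv_codeFP.comp (hc.pair hS))
  have hg := CodeFP.map (σ := ℕ × List Row) (eσ := pairE unE stCE) (eα := natE) (eβ := bitsE)
    (g := fun q => normV q.1.1 (prow q.1.2 q.2)) (normV_codeFP.comp (hn.pair (prow_codeFP.comp (hc.pair hS))))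
  have hctx : CodeFP (pairE unE matE) (pairE unE stCE) (fun p => (p.1, rrun p.1 p.2)) := (fst _ _).pair F2Elim.rrun_codeFP
  have h := hg.comp (hctx.pair (hf.comp (hctx.pair (urange.comp (fst _ _)))))
  exact h.congr fun _ => rfl

/-- The kernel basis on codes. [cite: AroraBarak2009, §1.3] -/
theorem kerOf_codeFP : CodeFP (pairE unE matE) matE (fun p => kerOf p.1 p.2) := by
  have hn : CodeFP (pairE (pairE unE stCE) natE) unE (fun q => q.1.1) := (fst _ _).fst'
  have hS : CodeFP (pairE (pairE unE stCE) natE) stCE (fun q => q.1.2) := (fst _ _).snd'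
  have hc : CodeFP (pairE (pairE unE stCE) natE) natE (fun q => q.2) := snd _ _
  have hf := CodeFP.filter (σ := ℕ × List Row) (eσ := pairE unE stCE) (eα := natE) (p := fun q => !isPiv q.1.2 q.2)
    (F2Elim.isPiv_codeFP.comp (hc.pair hS)).not
  have hg := CodeFP.map (σ := ℕ × List Row) (eσ := pairE unE stCE) (eα := natE) (eβ := bitsE)
    (g := fun q => kvec q.1.1 q.1.2 q.2) (F2Elim.kvec_codeFP.comp ((hn.pair hc).pair hS))
  have hctx : CodeFP (pairE unE matE) (pairE unE stCE) (fun p => (p.1, rrun p.1 p.2)) := (fst _ _).pair F2Elim.rrun_codeFP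
  have h := hg.comp (hctx.pair (hf.comp (hctx.pair (urange.comp (fst _ _)))))
  exact h.congr fun _ => rfl

/-- The bits of a numeral on codes: `(d, s) ↦ bitsOfNat d s` (`d` unary). [cite: AroraBarak2009, §1.3] -/
theorem bitsOfNat_codeFP : CodeFP (pairE unE natE) bitsE (fun p => bitsOfNat p.1 p.2) := by
  -- item `j` (binary, `< d`), context `(d, s)`; the exponent is `min j d = j` in unary
  have hd : CodeFP (pairE (pairE unE natE) natE) unE (fun q => q.1.1) := (fst _ _).fst'
  have hs : CodeFP (pairE (pairE unE natE) natE) natE (fun q => q.1.2) := (fst _ _).snd'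
  have hj : CodeFP (pairE (pairE unE natE) natE) unE (fun q => min q.2 q.1.1) := unOfNatMin.comp (hd.pair (snd _ _))
  have hg : CodeFP (pairE (pairE unE natE) natE) bitE (fun q => decide (q.1.2 / 2 ^ (min q.2 q.1.1) % 2 = 1)) :=
    natEq.comp ((natMod.comp ((natDiv.comp (hs.pair (natPow.comp ((const _ 2).pair hj)))).pair (const _ 2))).pair (const _ 1))
  have hm := CodeFP.map (σ := ℕ × ℕ) (eσ := pairE unE natE) (eα := natE) (eβ := bitE)
    (g := fun q => decide (q.1.2 / 2 ^ (min q.2 q.1.1) % 2 = 1)) hg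
  refine (hm.comp ((CodeFP.id _).pair (urange.comp (fst _ _)))).congr fun p => ?_
  refine List.map_congr_left fun j hj' => ?_
  simp only [id, min_eq_left (List.mem_range.1 hj').le]

/-- Budgeted span enumeration on codes: `((n, β), B) ↦ spanPrefix n β B` (`n`, `β` unary). [cite: AroraBarak2009, §1.3] -/
theorem spanPrefix_codeFP : CodeFP (pairE (pairE unE unE) matE) matE (fun t => spanPrefix t.1.1 t.1.2 t.2) := by
  have hn : CodeFP (pairE (pairE (pairE unE unE) matE) natE) unE (fun q => q.1.1.1) := (fst _ _).fst'.fst'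
  have hB : CodeFP (pairE (pairE (pairE unE unE) matE) natE) matE (fun q => q.1.2) := (fst _ _).snd'
  have hd : CodeFP (pairE (pairE (pairE unE unE) matE) natE) unE (fun q => q.1.2.length) := (ulength bitsE).comp hB
  have hg : CodeFP (pairE (pairE (pairE unE unE) matE) natE) bitsE (fun q => xorSel q.1.1.1 q.1.2 (bitsOfNat q.1.2.length q.2)) :=
    xorSel_codeFP.comp (hn.pair (hB.pair (bitsOfNat_codeFP.comp (hd.pair (snd _ _)))))
  have hm := CodeFP.map (σ := (ℕ × ℕ) × Mat) (eσ := pairE (pairE unE unE) matE) (eα := natE) (eβ := bitsE)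
    (g := fun q => xorSel q.1.1.1 q.1.2 (bitsOfNat q.1.2.length q.2)) hg
  have hpow : CodeFP (pairE (pairE unE unE) matE) natE (fun t => 2 ^ t.2.length) :=
    natPow.comp ((const _ 2).pair ((ulength bitsE).comp (snd _ _)))
  have hr : CodeFP (pairE (pairE unE unE) matE) (rawE natE) (fun t => List.range (min (2 ^ t.2.length) t.1.2)) :=
    rangeOf.comp ((fst _ _).snd'.pair hpow)
  exact (hm.comp ((CodeFP.id _).pair hr)).congr fun _ => rfl

/-! ### Radicals, the rank test and the seeds of the unit probes -/

/-- **The radical of the slice at `w`**: a basis of `ker B_w` (for the symmetric slices of a third-derivative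
tensor this is the radical `{u | T(u, w, ·) = 0}`). [cite: KipnisShamir1999, §4] -/
def radOf (n : ℕ) (T : Ten) (w : Vec) : Mat := kerOf n (sliceT n T w)

/-- **The rank test** of a candidate `u`: `u ≠ 0` and `2 · dim R_u ≥ n`. [cite: KipnisShamir1999, §4] -/
def rankTrue (n : ℕ) (T : Ten) (u : Vec) : Bool := u.any (fun b => b) && decide (n ≤ 2 * (radOf n T u).length)

/-- The seeds supplied by the probe `w`: the radical basis of `B_w` followed by the budgeted enumeration of
its span, filtered by the rank test. [cite: KipnisShamir1999, §4] -/
def probeSeeds (n bud : ℕ) (T : Ten) (w : Vec) : Mat :=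
  (radOf n T w ++ spanPrefix n bud (radOf n T w)).filter fun u => rankTrue n T u

/-- **The seed list**: the probe seeds of the unit vectors `e₀, …, e_{n-1}`, in this order. [cite: KipnisShamir1999, §4] -/
def seedsOf (n bud : ℕ) (T : Ten) : Mat := ((List.range n).map fun i => probeSeeds n bud T (unitL n i)).flatten

/-- The radical on codes: `(n, (T, w)) ↦ radOf n T w`. [cite: AroraBarak2009, §1.3] -/
theorem radOf_codeFP : CodeFP (pairE unE (pairE tenE bitsE)) matE (fun t => radOf t.1 t.2.1 t.2.2) :=
  (kerOf_codeFP.comp ((fst _ _).pair sliceT_codeFP)).congr fun _ => rfl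

/-- The rank test on codes: `(n, (T, u)) ↦ rankTrue n T u`. [cite: AroraBarak2009, §1.3] -/
theorem rankTrue_codeFP : CodeFP (pairE unE (pairE tenE bitsE)) bitE (fun t => rankTrue t.1 t.2.1 t.2.2) := by
  have hany := CodeFP.any (σ := Unit) (eσ := unitE) (eα := bitE) (p := fun q => q.2) (snd _ _)
  have h1 : CodeFP (pairE unE (pairE tenE bitsE)) bitE (fun t => t.2.2.any fun b => b) :=
    (hany.comp ((const _ ()).pair (snd _ _).snd')).congr fun _ => rfl
  have h2 : CodeFP (pairE unE (pairE tenE bitsE)) bitE (fun t => decide (t.1 ≤ 2 * (radOf t.1 t.2.1 t.2.2).length)) :=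
    natLe.comp ((natOfUn.comp (fst _ _)).pair (natMul.comp ((const _ 2).pair ((natLength bitsE).comp radOf_codeFP))))
  exact (h1.and h2).congr fun _ => rfl

/-- The code of the seed context `((n, β), (T, w))`. [folklore] -/
abbrev PE : (ℕ × ℕ) × (Ten × Vec) → List Bool := pairE (pairE unE unE) (pairE tenE bitsE)

/-- The probe seeds on codes. [cite: AroraBarak2009, §1.3] -/
theorem probeSeeds_codeFP : CodeFP PE matE (fun t => probeSeeds t.1.1 t.1.2 t.2.1 t.2.2) := by
  -- (no expected types on composite `have`s: unification against an ascription unfolds the bricks)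
  have hn : CodeFP PE unE (fun t => t.1.1) := (fst _ _).fst'
  have hR := radOf_codeFP.comp (hn.pair (snd (pairE unE unE) (pairE tenE bitsE)))
  have hL := (rawAppend bitsE).comp (hR.pair (spanPrefix_codeFP.comp ((fst (pairE unE unE) (pairE tenE bitsE)).pair hR)))
  have hf := CodeFP.filter (σ := (ℕ × ℕ) × (Ten × Vec)) (eσ := PE) (eα := bitsE) (p := fun q => rankTrue q.1.1.1 q.1.2.1 q.2)
    (rankTrue_codeFP.comp ((fst PE bitsE).fst'.fst'.pair ((fst PE bitsE).snd'.fst'.pair (snd PE bitsE))))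
  exact (hf.comp ((CodeFP.id _).pair hL)).congr fun _ => rfl

/-- **The seed list on codes**: `((n, β), T) ↦ seedsOf n β T`. [cite: AroraBarak2009, §1.3] -/
theorem seedsOf_codeFP : CodeFP (pairE (pairE unE unE) tenE) matE (fun t => seedsOf t.1.1 t.1.2 t.2) := by
  have hc : CodeFP (pairE (pairE (pairE unE unE) tenE) natE) (pairE unE unE) (fun q => q.1.1) := (fst _ _).fst'
  have hT : CodeFP (pairE (pairE (pairE unE unE) tenE) natE) tenE (fun q => q.1.2) := (fst _ _).snd'
  have hi : CodeFP (pairE (pairE (pairE unE unE) tenE) natE) natE (fun q => q.2) := snd _ _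
  have hg := probeSeeds_codeFP.comp (hc.pair (hT.pair (unitL_codeFP.comp (hc.fst'.pair hi))))
  have hm := CodeFP.map (σ := (ℕ × ℕ) × Ten) (eσ := pairE (pairE unE unE) tenE) (eα := natE) (eβ := matE)
    (g := fun q => probeSeeds q.1.1.1 q.1.1.2 q.1.2 (unitL q.1.1.1 q.2)) hg
  have h := (CodeFP.flatten bitsE).comp (hm.comp ((CodeFP.id _).pair (urange.comp (fst (pairE unE unE) tenE).fst')))
  exact h.congr fun _ => rfl

/-! ### The two-tensor orbit closure of a seed -/

/-- The images `A_z (B_w v)` of the rows `v` of `S` under all pairs of unit slices (`Bs` of the tensor of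
`g`, `As` of the tensor of `f`). [folklore] -/
def orbImgs (n : ℕ) (Bs As : List Mat) (S : Mat) : Mat :=
  (S.product (Bs.product As)).map fun t => mulVec n t.2.2 (mulVec n t.2.1 t.1)

/-- **One closure round**: replace `S` by a basis of `S` together with its images, unless the dimension
already exceeds `m` (then the orbit has FAILED and is frozen). [folklore] -/
def orbStep (n m : ℕ) (Bs As : List Mat) (S : Mat) : Mat :=
  if decide (m < S.length) then S else basisOf n (S ++ orbImgs n Bs As S)

/-- **The orbit of a seed** `s`: `m + 1` closure rounds from the basis of `[s]` (enough to stabilise at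
dimension `≤ m` or to overshoot); the result FAILED iff it has more than `m` rows. [folklore] -/
def orbitOf (n m : ℕ) (Bs As : List Mat) (s : Vec) : Mat :=
  (List.replicate (m + 1) ()).foldl (fun S _ => orbStep n m Bs As S) (basisOf n [s])

/-- The code of the orbit context `(n, (m, (Bs, As)))`. [folklore] -/
abbrev OE : ℕ × (ℕ × (List Mat × List Mat)) → List Bool := pairE unE (pairE unE (pairE (rawE matE) (rawE matE)))

/-- The images on codes: `((n, (m, (Bs, As))), S) ↦ orbImgs n Bs As S`. [cite: AroraBarak2009, §1.3] -/
theorem orbImgs_codeFP : CodeFP (pairE OE matE) matE (fun t => orbImgs t.1.1 t.1.2.2.1 t.1.2.2.2 t.2) := by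
  -- item context `n`, item `(v, (B, A))`
  have hn : CodeFP (pairE unE (pairE bitsE (pairE matE matE))) unE (fun q => q.1) := fst _ _
  have hv : CodeFP (pairE unE (pairE bitsE (pairE matE matE))) bitsE (fun q => q.2.1) := (snd _ _).fst'
  have hB : CodeFP (pairE unE (pairE bitsE (pairE matE matE))) matE (fun q => q.2.2.1) := (snd _ _).snd'.fst'
  have hA : CodeFP (pairE unE (pairE bitsE (pairE matE matE))) matE (fun q => q.2.2.2) := (snd _ _).snd'.snd'
  have hg := mulVec_codeFP.comp (hn.pair (hA.pair (mulVec_codeFP.comp (hn.pair (hB.pair hv)))))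
  have hm := CodeFP.map (σ := ℕ) (eσ := unE) (eα := pairE bitsE (pairE matE matE)) (eβ := bitsE)
    (g := fun q => mulVec q.1 q.2.2.2 (mulVec q.1 q.2.2.1 q.2.1)) hg
  have hS : CodeFP (pairE OE matE) matE (fun t => t.2) := snd _ _
  have hBs : CodeFP (pairE OE matE) (rawE matE) (fun t => t.1.2.2.1) := (fst _ _).snd'.snd'.fst'
  have hAs : CodeFP (pairE OE matE) (rawE matE) (fun t => t.1.2.2.2) := (fst _ _).snd'.snd'.snd'
  have hprod := (rawProduct bitsE (pairE matE matE)).comp (hS.pair ((rawProduct matE matE).comp (hBs.pair hAs)))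
  exact (hm.comp ((fst OE matE).fst'.pair hprod)).congr fun _ => rfl

/-- One closure round on codes. [cite: AroraBarak2009, §1.3] -/
theorem orbStep_codeFP : CodeFP (pairE OE matE) matE (fun t => orbStep t.1.1 t.1.2.1 t.1.2.2.1 t.1.2.2.2 t.2) := by
  have hS : CodeFP (pairE OE matE) matE (fun t => t.2) := snd _ _
  have hn : CodeFP (pairE OE matE) unE (fun t => t.1.1) := (fst _ _).fst'
  have hm : CodeFP (pairE OE matE) unE (fun t => t.1.2.1) := (fst _ _).snd'.fst'
  have hc := natLt.comp ((natOfUn.comp hm).pair ((natLength bitsE).comp hS))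
  have hb := basisOf_codeFP.comp (hn.pair ((rawAppend bitsE).comp (hS.pair orbImgs_codeFP)))
  exact (hc.ite hS hb).congr fun _ => rfl

/-- `orbStep` keeps the shape (at most `n` rows of at most `n` bits). [folklore] -/
theorem shaped_orbStep (n m : ℕ) (Bs As : List Mat) {S : Mat} (h : S.length ≤ n ∧ ∀ r ∈ S, r.length ≤ n) :
    (orbStep n m Bs As S).length ≤ n ∧ ∀ r ∈ orbStep n m Bs As S, r.length ≤ n := by
  unfold orbStep; split_ifs
  · exact h
  · exact shaped_basisOf n _

/-- **The orbit on codes**: `((n, (m, (Bs, As))), s) ↦ orbitOf n m Bs As s` — a fold over `m + 1` unit budget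
items whose state keeps the shape invariant (`foldlInv`). [cite: AroraBarak2009, §1.3] -/
theorem orbitOf_codeFP : CodeFP (pairE OE bitsE) matE (fun t => orbitOf t.1.1 t.1.2.1 t.1.2.2.1 t.1.2.2.2 t.2) := by
  have hstep := orbStep_codeFP.comp ((fst (pairE OE bitsE) (pairE unitE matE)).fst'.pair (snd (pairE OE bitsE) (pairE unitE matE)).snd')
  have hinit := basisOf_codeFP.comp ((fst OE bitsE).fst'.pair ((rawSingleton bitsE).comp (snd OE bitsE)))
  have hfold := foldlInv (σ := (ℕ × (ℕ × (List Mat × List Mat))) × Vec) (α := Unit) (β := Mat) (eσ := pairE OE bitsE)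
    (eα := unitE) (eβ := matE)
    (step := fun c _ S => orbStep c.1.1 c.1.2.1 c.1.2.2.1 c.1.2.2.2 S) (init := fun c => basisOf c.1.1 [c.2])
    (fun c S => S.length ≤ c.1.1 ∧ ∀ r ∈ S, r.length ≤ c.1.1) hstep hinit shapeP
    (fun c => shaped_basisOf _ _) (fun c _ S hS => shaped_orbStep _ _ _ _ hS)
    (fun c S hS => length_matE_le_shapeP hS (by simp only [pairE_apply, length_boolPair, length_unE]; omega))
  have h := hfold.comp ((CodeFP.id _).pair (replicateUnit.comp (unSucc.comp (fst OE bitsE).snd'.fst')))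
  exact h.congr fun _ => rfl

/-- **The bricks of the finder, on codes** (registered brick of stmt-QuantumAdvantage-13932, line
`dual-pingpong-frame`): the seed list and the orbit closure are typed polynomial time. [cite: AroraBarak2009, §1.3] -/
theorem bricks_codeFP : CodeFP (pairE (pairE unE unE) tenE) matE (fun t => seedsOf t.1.1 t.1.2 t.2) ∧ CodeFP (pairE OE bitsE) matE (fun t => orbitOf t.1.1 t.1.2.1 t.1.2.2.1 t.1.2.2.2 t.2) :=
  ⟨seedsOf_codeFP, orbitOf_codeFP⟩

end Summit.QuantumAdvantage.QuantumAdvantage.Theorems.SignedExactCubicForrelationNotPrBPP.FinderMachine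

end
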